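import Summits.BirchSwinnertonDyer.Rank1Residual.Supersingular.SignedSqueeze
import HarnessLib

/-!
# Signed main conjecture AT A PAIR — the X7 / X6 (±, `a_p = 0`) readings of `SignedSqueeze.lean`
# (cell `b2b-bsdres`, supersingular family, prover B = unit `b2b-bsdres-additive-p3`, gen 2; joint X7 step)

HONEST FRAMING (run/shared/lean/b2b/bsd-rank1-residual/, verbatim in every file): the goal of the
cell is to DELETE the COMBINATION-SHAPED residual classes of the Birch–Swinnerton-Dyer formula for
ALL analytic-rank `≤ 1` elliptic curves over `ℚ` — "full BSD formula for every rank `≤ 1` curve in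
class `C`" assembled STRICTLY from published theorems — so that the rank-`≤ 1` remainder becomes
exactly the CONSTRUCTION-SHAPED classes, which are TYPED (missing-input `Prop`s), NOT attempted.
This is not "finishing BSD". Research route; no claim beyond the stated classes. X6 / X7 stay
CONSTRUCTION-SHAPED; per-pair readings only, NOT class theorems; nothing about any curve is asserted;
nothing is booked. Theorems only (compositions of `SignedSqueeze.lean` with the tree's image lemmas).

`SignedSqueeze.lean` proves, on prover A's sign-agnostic `SignedDatum W p = (ξ, L, c)`: rank one —
(MC↑) `ξ ∣ L` + (C) `T^{rank} ∣ ξ` + the two-engine certificate `(μ, λ)(L) = (0, 1)` ⇒ `(ξ) = (L)`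
(`SignedDatum.charIdealEq_of_lam_eq_one`); rank zero — (K) + (P) + `p ∤ c` + (MC↑) + `BSD(E,p)` ⇒
`(ξ) = (L)` and the exact form `BSD(E,p) ⟺ (ξ) = (L)`. For `a_p = 0` the datum is Kobayashi's ±
(`ξ^ε`, Pollack's `L^ε_p`): (MC↑) integral = Kobayashi, Invent. Math. 152 (2003) Thm. 1.3 (ii) /
Thm. 4.1 with `n = 0` under `p`-ADIC surjectivity; (C) = Kobayashi Thm. 9.3 (control) + structure
theory; (K) = B. D. Kim 2013 / Sprung 2024 Lemmas 5.5–5.9; (P) = Pollack 2003 (tree: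
`PlusMinusPAdicLFunction.lean`). The image hypothesis is DISCHARGED here: at `p ≥ 5` mod-`p`
surjectivity gives `p`-adic surjectivity (Serre; tree THEOREM `serre_hasSurjectiveModNGaloisRep_pow_holds`),
at `p = 3` (`a_3 = 0`) Wuthrich, Doc. Math. 19 (2014) Lemma 20 needs only `3² ∤ N` — true at a good
prime, so X7's non-semistability is no obstacle (named fact `hL20`).

* **X7 ∧ r_an = 1** (72 pairs, `a_p = 0`, ±; iw-2 `tables/ss_support_X678.tsv`, N < 2·10⁴, two engines):
  `min(λ_+, λ_−) = 1` with `μ = 0` on 31 pairs — 17 at `p ≥ 5` (11 at `5`, 3 at `7`, 3 at `11`), 13 at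
  `p = 3` with surj(3), 1 at `p = 3` without. On the 30 with `ρ̄_{E,p}` onto,
  `X7.charIdealEq_of_lam_eq_one_of_analyticRank_eq_one` (image hypothesis via
  `surjective_pow_of_surj_of_good`) reads: Kobayashi's main conjecture `(ξ^ε) = (L^ε_p)` AT THE PAIR,
  granted (MC↑), (C) as displayed and the certificate. What then remains for `BSD(E,p)` there is the
  rank-one leading-term link (Kobayashi, Invent. Math. 191 (2013), `a_p = 0`; flag
  `KOB13-primary-unread`) — prover A's side of the joint X7 step.

* **X7 / X6 ∧ r_an = 0**: wherever `BSD(E,p)` is settled from published inputs (Wuthrich-L1,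
  visibility certificates, descent bits), the converse gives Kobayashi's main conjecture at the pair
  for any ± datum with (K), (P), `p ∤ c` and integral (MC↑) (`X7.|X6.charIdealEq_of_bsdp_…`).

References: Kobayashi, Invent. Math. 152 (2003) Thms. 1.2, 1.3, 4.1, 9.3 [Kobayashi2003]; Kobayashi,
Invent. Math. 191 (2013) [Kobayashi2013]; Sprung, J. Number Theory 132 (2012) Thm. 7.16 [Sprung2012];
Greenberg–Vatsal, Invent. Math. 142 (2000) p. 4 [GreenbergVatsal2000]; Wuthrich, Doc. Math. 19 (2014)
Lemma 20 (p. 399) [Wuthrich2014]; Serre 1968 Ch. IV §3.4 [SerreAbelianLadic1968]; Serre 1972 Prop. 12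
[Serre1972]; Miller 2011 Def. 1.1 [Miller2011LMS]; iw-2 `SS-SUPPORT-X678.md` (two-engine (μ, λ)).
-/

set_option autoImplicit false

noncomputable section

open scoped Classical

open WeierstrassCurve Literature.NumberTheory.EllipticCurves
  Literature.NumberTheory.EllipticCurves.Rank1Residual
  Literature.NumberTheory.EllipticCurves.Rank1Residual.Typed
  Summit.BirchSwinnertonDyer.Rank1Residual.X1.MuLambda

namespace Summit.BirchSwinnertonDyer.Rank1Residual.Supersingular

section Classes

variable (W : WeierstrassCurve ℚ) [W.IsElliptic] [W.IsGloballyMinimal] (p : ℕ) [Fact p.Prime]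

omit [W.IsGloballyMinimal] in
/-- **`p`-adic surjectivity from mod-`p` surjectivity at a GOOD odd prime** — the image hypothesis of
the integral Kato divisibility (Kobayashi 2003 Thm. 1.3 (ii); Sprung 2012 Thm. 7.16, `n = 0`): at
`p ≥ 5` by Serre (tree THEOREM `serre_hasSurjectiveModNGaloisRep_pow_holds`), at `p = 3` by Wuthrich,
Doc. Math. 19 (2014) Lemma 20 (`hL20`: "Let `p = 3` and suppose `p²` does not divide the conductor
`N`. If `ρ̄` is surjective then `ρ` is surjective, too" — `3² ∤ N` because `3` is good; semistability
is not needed). [cite: SerreAbelianLadic1968, Ch. IV §3.4] [cite: Wuthrich2014, Lemma 20 (p. 399)] -/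
theorem surjective_pow_of_surj_of_good
    (hL20 : Wuthrich2014.lemma20_surjective_threeAdic_of_semistable)
    (hp : p ≠ 2) (hgood : W.HasGoodReductionAtPrime p) (hs : Surj W p) :
    ∀ n : ℕ, W.HasSurjectiveModNGaloisRep (p ^ n : ℕ) := by
  by_cases hp5 : 5 ≤ p
  · exact serre_hasSurjectiveModNGaloisRep_pow_holds W p hp5 hs
  · have hpp : p.Prime := Fact.out
    have hp3 : p = 3 := by
      have h2 : 2 ≤ p := hpp.two_le
      have h5 : p < 5 := not_le.mp hp5
      interval_cases p
      · exact absurd rfl hp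
      · rfl
      · exact absurd hpp (by decide)
    subst hp3
    exact hL20 W (Or.inl hgood) hs

omit [W.IsGloballyMinimal] in
/-- **`r_an = 1` ∧ surj(p), `p ≥ 5` (`a_p = 0`, ±): Kobayashi's main conjecture AT THE PAIR from the
λ-certificate**, class-agnostic. At `p ≥ 5`, `ρ̄_{E,p}` onto ⇒ `ρ_{E,p^∞}` onto (Serre) is the image
hypothesis of Kobayashi 2003 Thm. 1.3 (ii) / Thm. 4.1 with `n = 0` (binder `hKato`); with control (C)
(Kobayashi Thm. 9.3; displayed), GZK and the two-engine certificate `(μ_ε, λ_ε) = (0, 1)`: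
`(ξ^ε) = (L^ε_p)` at the pair. [cite: Kobayashi2003, Thms. 1.3, 4.1, 9.3] [cite: SerreAbelianLadic1968, Ch. IV §3.4]
[cite: GreenbergVatsal2000, p. 4] -/
theorem charIdealEq_of_lam_eq_one_of_five_le_of_surj_of_analyticRank_eq_one
    (hGZK : rank_eq_analyticRank_of_analyticRank_le_one)
    (hp5 : 5 ≤ p) (hs : Surj W p) (h1 : W.analyticRank = 1)
    (D : SignedDatum W p) (hC : D.OrderOfVanishing)
    (hKato : (∀ n : ℕ, W.HasSurjectiveModNGaloisRep (p ^ n : ℕ)) → D.UpperDivisibility)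
    (hμ : mu D.L = 0) (hlam : lam D.L = 1) : D.CharIdealEq :=
  D.charIdealEq_of_lam_eq_one hGZK h1 hC
    (hKato (serre_hasSurjectiveModNGaloisRep_pow_holds W p hp5 hs)) hμ hlam

/-- **X7 ∧ `r_an = 1` ∧ odd `p` ∧ surj(p): Kobayashi's (at `p = 3`, `a_3 = 0`) signed main conjecture
AT THE PAIR from the λ-certificate.** The image hypothesis of (MC↑) is discharged by
`surjective_pow_of_surj_of_good` (Serre at `p ≥ 5`; Lemma 20 at `p = 3`, where mod-`3` surjectivity
alone would not suffice (Elkies) but `3² ∤ N` holds at the good prime). Census (iw-2, N < 2·10⁴, two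
engines): 31 of the 72 X7 rank-one pairs have `min(λ_+, λ_−) = 1`, `μ = 0` — 17 at `p ≥ 5` (11 at `5`,
3 at `7`, 3 at `11`), 13 at `p = 3` with surj(3), 1 at `p = 3` without. What then remains for `BSD(E,p)`
at such a pair is the rank-one leading-term link (Kobayashi, Invent. Math. 191 (2013): `a_p = 0`; flag
`KOB13-primary-unread`) — prover A's side. Per pair; NOT a class theorem.
[cite: Kobayashi2003, Thms. 1.3, 4.1, 9.3] [cite: Wuthrich2014, Lemma 20 (p. 399)] [cite: GreenbergVatsal2000, p. 4] -/
theorem X7.charIdealEq_of_lam_eq_one_of_analyticRank_eq_one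
    (hL20 : Wuthrich2014.lemma20_surjective_threeAdic_of_semistable)
    (hGZK : rank_eq_analyticRank_of_analyticRank_le_one)
    (hp : p ≠ 2) (hX : ClassX7 W p) (hs : Surj W p) (h1 : W.analyticRank = 1)
    (D : SignedDatum W p) (hC : D.OrderOfVanishing)
    (hKato : (∀ n : ℕ, W.HasSurjectiveModNGaloisRep (p ^ n : ℕ)) → D.UpperDivisibility)
    (hμ : mu D.L = 0) (hlam : lam D.L = 1) : D.CharIdealEq :=
  D.charIdealEq_of_lam_eq_one hGZK h1 hC
    (hKato (surjective_pow_of_surj_of_good W p hL20 hp hX.1.1 hs)) hμ hlam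

/-- **X7 ∧ `r_an = 0` ∧ odd `p` ∧ surj(p): a settled `BSD(E,p)` gives the signed main conjecture at the
pair** (converse reading of p207423), for a datum with (K), (P), `p ∤ c` and the integral (MC↑) whose
image hypothesis is discharged as above. Irreducibility automatic (`ClassX7.irr`); modularity `hmod`
for `L(E,1) ≠ 0`. [cite: Kobayashi2003, Thms. 1.2, 1.3] [cite: Sprung2012, Thm. 7.16 (p. 1504)]
[cite: Wuthrich2014, Lemma 20 (p. 399)] [cite: Serre1972, §1.11 Prop. 12] [cite: Miller2011LMS, Def. 1.1] -/
theorem X7.charIdealEq_of_bsdp_of_analyticRank_eq_zero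
    (hL20 : Wuthrich2014.lemma20_surjective_threeAdic_of_semistable)
    (hGZK : rank_eq_analyticRank_of_analyticRank_le_one) (hmod : hasEntireLFunction_rat)
    (hp : p ≠ 2) (hX : ClassX7 W p) (hs : Surj W p) (h0 : W.analyticRank = 0) (hB : BSDp W p)
    (D : SignedDatum W p) (hc : ¬ p ∣ D.c) (hK : D.EulerCharacteristic) (hP : D.Interpolation)
    (hKato : (∀ n : ℕ, W.HasSurjectiveModNGaloisRep (p ^ n : ℕ)) → D.UpperDivisibility) :
    D.CharIdealEq :=
  D.charIdealEq_of_bsdp_of_analyticRank_eq_zero hGZK (ClassX7.irr W p hp hX)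
    ((W.analyticRank_eq_zero_iff_holds (hmod W)).1 h0) hc hK hP
    (hKato (surjective_pow_of_surj_of_good W p hL20 hp hX.1.1 hs)) hB

/-- **X6 ∧ `r_an = 0` ∧ odd `p`: a settled `BSD(E,p)` gives Kobayashi's main conjecture at the pair**
(converse reading of prover A's p206397), for a datum with (K), (P), `p ∤ c` and the integral (MC↑) —
its image hypothesis AUTOMATIC on X6: `ρ̄_{E,p}` onto by `ClassX6.surj` (Serre 1972 Prop. 21, semistable),
then `p`-adic surjectivity by Serre (`p ≥ 5`) / Lemma 20 (`p = 3`). Irreducibility automatic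
(`ClassX6.irr`). So at each of the X6 rank-`0` pairs the cell has settled (Wuthrich-L1, the visibility
certificates of `X6VisibilityRecords.lean`) Kobayashi's `(ξ^ε) = (L^ε_p)` holds for every ± datum with
(K), (P), (MC↑). [cite: Kobayashi2003, Thms. 1.2, 1.3] [cite: Serre1972, §1.11 Prop. 12 and §5.4 Prop. 21 i)]
[cite: Wuthrich2014, Lemma 20 (p. 399)] [cite: Miller2011LMS, Def. 1.1] -/
theorem X6.charIdealEq_of_bsdp_of_analyticRank_eq_zero
    (hL20 : Wuthrich2014.lemma20_surjective_threeAdic_of_semistable)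
    (hGZK : rank_eq_analyticRank_of_analyticRank_le_one) (hmod : hasEntireLFunction_rat)
    (hp : p ≠ 2) (hX : ClassX6 W p) (h0 : W.analyticRank = 0) (hB : BSDp W p)
    (D : SignedDatum W p) (hc : ¬ p ∣ D.c) (hK : D.EulerCharacteristic) (hP : D.Interpolation)
    (hKato : (∀ n : ℕ, W.HasSurjectiveModNGaloisRep (p ^ n : ℕ)) → D.UpperDivisibility) :
    D.CharIdealEq :=
  D.charIdealEq_of_bsdp_of_analyticRank_eq_zero hGZK (ClassX6.irr W p hp hX)
    ((W.analyticRank_eq_zero_iff_holds (hmod W)).1 h0) hc hK hP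
    (hKato (surjective_pow_of_surj_of_good W p hL20 hp hX.1.1 (ClassX6.surj W p hp hX))) hB

end Classes

end Summit.BirchSwinnertonDyer.Rank1Residual.Supersingular

end
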